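import Summits.ResolutionOfSingularities.ResolutionOfSingularities.Theorems.EquisingularLiftEquisingularLiftNatSecondOrderALadder
import HarnessLib

/-!
# [OURS] THE DOUBLE-PLANE (`D/E`) LADDER STEP in polynomial currency: vertex charts `f = y₂² + Ψ`, `Ψ ∈ (y)³` (tangent cone a DOUBLE PLANE),
# every field: chart `2` has NO exceptional points; in chart `l ∈ {0,1}` the strict transform is `G_l = c·T_l + (T₂² + T_l·L) + T_l·p₂`; the
# exceptional singular points satisfy `T₂ ∈ P` and `c + L + p₂ ∈ P` (the ROOTS of the cubic form on the double line); `c ≠ 0` ⟹ the chart origin is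
# a regular point; at a SIMPLE root (`∂L/∂T_{1-l} ≠ 0`) the exceptional point is FIRST-ORDER in every characteristic — `D₄ → 3` nodes, `D_n`, `E₆ → A₅`, …
# (cruxes `Theses.EquisingularLift.EquisingularLiftNat` / `…NatThree` / `EquisingularLift`, stmt-ResolutionOfSingularities-20038 / -20148 / -15660)

[OURS · leafhand-res-equisingularlift-11 g0, 2026-08-31; cell `pub/decomp-res`] AI-produced, weaker than expert review; NOT a statement of any manuscript;
nothing here proves resolution of singularities in positive characteristic.  DEF-FREE helper; no `sorry`; standard axioms; ZERO named hypotheses.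

Companion of ✓ `…NatSecondOrderALadder` (p832631; tangent cone two transversal planes).  Here the tangent cone is the double plane `y₂²` — the `D_n`,
`E₆, E₇, E₈` surface points and everything worse.  Writing `Ψ = Ψ₃ + Ψ₄ + …` in forms, the strict transform meets the exceptional `ℙ²` in the DOUBLE LINE
`{y₂ = 0}`, and is singular there exactly at the roots of the binary cubic `b = Ψ₃(y₀, y₁, 0)` (classical; `b ≡ 0` = a whole singular curve upstairs =
infinite depth at this level).  In the tree's chart currency (✓ `FirstOrderPoint.exists_strictTransform`: `y_j ↦ T_l·T_j (j ≠ l)`, `y_l ↦ T_l`):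

* `SecondOrderPoint.not_mem_of_sub_one_mem_span` — if `G ≡ 1 (mod T_l)` no prime contains both `T_l` and `G`: **chart `2` of a double-plane point has no
  exceptional points** (`SecondOrderPoint.doublePlane_chart₂`: `f(T₂T₀, T₂T₁, T₂) = T₂²·(1 + T₂R)`);
* ★★★ `SecondOrderPoint.doublePlane_ladder_chart` — for `l ≠ 2`: `f(σ_l) = T_l²·G_l`, `G_l = C(c)·T_l + (T₂² + T_l·L) + T_l·p₂` with `L` a linear form,
  `p₂ ∈ (T)²`, `T₂² + T_lL` a quadratic form; at a prime `P ∋ T_l` with `G_l, ∂_lG_l ∈ P`: `T₂ ∈ P` and `C(c) + L + p₂ ∈ P` (the root condition); and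
  `c ≠ 0` ⟹ at every prime containing all `T_i` some `∂_jG_l ∉ P` (the chart origin is a regular point of the strict transform: `c = Ψ₃(e_l)`, i.e.
  `e_l` is not a root of `b`);
* `SecondOrderPoint.firstOrder_doublePlane_disc` — (FO), every characteristic, for the exceptional tangent cone `Φ' = T₂² + T₀(aT₀ + βT₁ + c'T₂)` with
  `β ≠ 0` (a SIMPLE root of `b` at the origin of chart `0`), any next form;
* ★★ `SecondOrderPoint.doublePlane_simpleRoot_chart₀` — RECOGNITION at the origin of chart `0`: `f = y₂² + (y₀²(βy₁ + c'y₂) + Ψ₃⁰) + (a·y₀⁴ + Ψ₄⁰ + Ψ₅)`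
  with `Ψ₃⁰ ∈ (y₁,y₂)²` a cubic form (so `b = βy₀²y₁ + …` has the SIMPLE root `[1:0]` when `β ≠ 0`), `Ψ₄⁰ ∈ (y₁,y₂)` a quartic form, `Ψ₅ ∈ (y)⁵`, `β ≠ 0`
  ⟹ `G₀ = Φ' + (Ψ₁' + Ψ'')` with `Φ'` as above, `Ψ₁'` a cubic form, `Ψ'' ∈ (T)⁴`, and the origin of chart `0` is ONE-STEP for `G₀` (explicit strict
  transforms with Jacobian certificates, ✓ `FirstOrderPoint.exists_strictTransform`).

So: `D₄` (three simple roots) has, over the vertex, three exceptional singular points, each first-order — level `1` (polynomial half; the other two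
roots are reached by the coordinate changes `y₀ ↔ y₁`, `y₁ ↦ y₁ + ρy₀`, ✓ …NatFirstOrderLinSubst for the transport); at a double/triple root of `b`
(`β = 0`) the exceptional tangent cone `T₂² + T₀(aT₀ + c'T₂)` is a binary quadric: two planes (✓ `A_ladder_chart₂` continues) or a double plane again
(this file continues) — the `D_n / E` cascade.  NOT done: the termination measure and the scheme-side bridge to the depth towers.  Honest label: pure
algebra; closes no registered stub.

References: [Hartshorne1977, I Thm. 5.1, I Ex. 5.6, II Ex. 7.12, V Ex. 5.?]; the `ADE` cascade under point blow-ups (`D₄ → 3A₁`, `D_n → D_{n-2}+…`,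
`E₆ → A₅`, `E₇ → D₆`, `E₈ → E₇`) is classical [Lipman1969, §24]; through the cited tree files.
-/

set_option linter.dupNamespace false -- mandated namespace `Summit.<Summit>.<Problem>` of this single-conjunct summit

noncomputable section

open MvPolynomial

namespace Summit.ResolutionOfSingularities.ResolutionOfSingularities.Cruxes.EquisingularLiftNat.Sections

namespace SecondOrderPoint

variable (K : Type) [Field K] {n : ℕ}

/-! ## Chart `2`: no exceptional points -/

/-- If `G ≡ 1 (mod T_l)` then no prime ideal contains both `T_l` and `G`. [folklore] -/
theorem not_mem_of_sub_one_mem_span {l : Fin n} {G : MvPolynomial (Fin n) K} (hG : G - 1 ∈ Ideal.span {(X l : MvPolynomial (Fin n) K)})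
    (P : Ideal (MvPolynomial (Fin n) K)) (hP : P.IsPrime) (hl : (X l : MvPolynomial (Fin n) K) ∈ P) : G ∉ P := by
  obtain ⟨R, hR⟩ := Ideal.mem_span_singleton'.mp hG
  intro h
  have h1 : (1 : MvPolynomial (Fin n) K) = G - R * X l := by rw [hR]; ring
  exact hP.ne_top ((Ideal.eq_top_iff_one P).mpr (h1 ▸ P.sub_mem h (P.mul_mem_left _ hl)))

/-- ★ **Chart `2` of a double-plane point has NO exceptional points**: for `f = y₂² + Ψ`, `Ψ ∈ (y)³`: `f(T₂T₀, T₂T₁, T₂) = T₂²·G₂` with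
`G₂ - 1 ∈ (T₂)`, so the Jacobian clause at the primes `P ∋ T₂, G₂` holds vacuously. [cite: Hartshorne1977, II Ex. 7.12] -/
theorem doublePlane_chart₂ {Ψ : MvPolynomial (Fin 3) K} (hΨ : Ψ ∈ Ideal.span (Set.range (X : Fin 3 → MvPolynomial (Fin 3) K)) ^ 3) :
    ∃ G : MvPolynomial (Fin 3) K,
      aeval (fun j => X 2 * Function.update (X : Fin 3 → MvPolynomial (Fin 3) K) 2 1 j) (X 2 ^ 2 + Ψ) = X 2 ^ 2 * G ∧
      G - 1 ∈ Ideal.span {(X 2 : MvPolynomial (Fin 3) K)} ∧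
      ∀ P : Ideal (MvPolynomial (Fin 3) K), P.IsPrime → (X 2 : MvPolynomial (Fin 3) K) ∈ P → G ∈ P → ∃ j, pderiv j G ∉ P := by
  obtain ⟨R, hR⟩ := FirstOrderPoint.exists_aeval_subst_eq_pow_mul K 2 hΨ
  have h1 : (1 + X 2 * R : MvPolynomial (Fin 3) K) - 1 ∈ Ideal.span {(X 2 : MvPolynomial (Fin 3) K)} :=
    Ideal.mem_span_singleton'.mpr ⟨R, by ring⟩
  refine ⟨1 + X 2 * R, ?_, h1, fun P hP h2 hG => absurd hG (not_mem_of_sub_one_mem_span K h1 P hP h2)⟩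
  rw [map_add, map_pow, aeval_X, Function.update_self, hR]
  ring

/-! ## ★★★ Charts `l ≠ 2`: the ladder form -/

/-- The chart-`l` substitution on `y₂²`, `l ≠ 2`: `(T_lT₂)² = T_l²·T₂²`. [folklore] -/
theorem aeval_subst_X_two_sq (l : Fin 3) (hl : l ≠ 2) :
    aeval (fun j => X l * Function.update (X : Fin 3 → MvPolynomial (Fin 3) K) l 1 j) (X 2 ^ 2 : MvPolynomial (Fin 3) K) =
      X l ^ 2 * X 2 ^ 2 := by
  rw [map_pow, aeval_X, Function.update_of_ne (Ne.symm hl)]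
  ring

/-- ★★★ **THE DOUBLE-PLANE LADDER STEP, chart `l ≠ 2`.**  `f = y₂² + Ψ`, `Ψ ∈ (y)³`, any field.  There are `c ∈ K`, a linear form `L` and
`p₂ ∈ (T)²` with `G_l = C(c)·T_l + (T₂² + T_l·L) + T_l·p₂` such that: (i) `f(σ_l) = T_l²·G_l`; (ii) `T₂² + T_lL` is a quadratic form; (iii) at a
prime `P ∋ T_l` with `G_l ∈ P` and `∂_lG_l ∈ P`: `T₂ ∈ P` and `C(c) + L + p₂ ∈ P` (the exceptional singular points lie on the double line and at
the roots); (iv) if `c ≠ 0`, at every prime containing all the `T_i` some `∂_jG_l ∉ P` (the chart origin is a regular point).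
[cite: Hartshorne1977, I Thm. 5.1, II Ex. 7.12] -/
theorem doublePlane_ladder_chart (l : Fin 3) (hl : l ≠ 2) {Ψ : MvPolynomial (Fin 3) K}
    (hΨ : Ψ ∈ Ideal.span (Set.range (X : Fin 3 → MvPolynomial (Fin 3) K)) ^ 3) :
    ∃ (c : K) (L p₂ : MvPolynomial (Fin 3) K), L.IsHomogeneous 1 ∧ p₂ ∈ Ideal.span (Set.range (X : Fin 3 → MvPolynomial (Fin 3) K)) ^ 2 ∧
      aeval (fun j => X l * Function.update (X : Fin 3 → MvPolynomial (Fin 3) K) l 1 j) (X 2 ^ 2 + Ψ) =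
        X l ^ 2 * (C c * X l + (X 2 ^ 2 + X l * L) + X l * p₂) ∧
      (X 2 ^ 2 + X l * L : MvPolynomial (Fin 3) K).IsHomogeneous 2 ∧
      (∀ P : Ideal (MvPolynomial (Fin 3) K), P.IsPrime → (X l : MvPolynomial (Fin 3) K) ∈ P →
        (C c * X l + (X 2 ^ 2 + X l * L) + X l * p₂) ∈ P → pderiv l (C c * X l + (X 2 ^ 2 + X l * L) + X l * p₂) ∈ P →
        (X 2 : MvPolynomial (Fin 3) K) ∈ P ∧ C c + L + p₂ ∈ P) ∧
      (c ≠ 0 → ∀ P : Ideal (MvPolynomial (Fin 3) K), P.IsPrime → (∀ i, (X i : MvPolynomial (Fin 3) K) ∈ P) →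
        ∃ j, pderiv j (C c * X l + (X 2 ^ 2 + X l * L) + X l * p₂) ∉ P) := by
  obtain ⟨R, hR⟩ := FirstOrderPoint.exists_aeval_subst_eq_pow_mul K l hΨ
  obtain ⟨L, p₂, hL, hp₂, hsplit⟩ := exists_split_const_linear K R
  have hR' : aeval (fun j => X l * Function.update (X : Fin 3 → MvPolynomial (Fin 3) K) l 1 j) Ψ =
      X l ^ 3 * (C (coeff 0 R) + L + p₂) := by
    rw [hR]; exact congrArg (fun q => X l ^ 3 * q) hsplit
  set I : Ideal (MvPolynomial (Fin 3) K) := Ideal.span (Set.range (X : Fin 3 → MvPolynomial (Fin 3) K)) with hIdef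
  -- the partial `∂_l G_l = C c + (L + T_l ∂_l L) + (p₂ + T_l ∂_l p₂)` (`∂_l T₂² = 0` as `l ≠ 2`)
  have hdl : pderiv l (C (coeff 0 R) * X l + (X 2 ^ 2 + X l * L) + X l * p₂ : MvPolynomial (Fin 3) K) =
      C (coeff 0 R) + (L + X l * pderiv l L) + (p₂ + X l * pderiv l p₂) := by
    simp only [map_add, pderiv_mul, pderiv_C, pderiv_pow, pderiv_X_self, pderiv_X_of_ne (Ne.symm hl)]
    ring
  refine ⟨coeff 0 R, L, p₂, hL, hp₂, ?_, ?_, ?_, ?_⟩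
  · -- (i)
    rw [map_add, aeval_subst_X_two_sq K l hl, hR']
    ring
  · -- (ii)
    have h := (isHomogeneous_X_pow (2 : Fin 3) 2 (R := K)).add ((isHomogeneous_X K l).mul hL)
    simpa using h
  · -- (iii)
    intro P hP hXl hG hd
    have h2 : (X 2 : MvPolynomial (Fin 3) K) ∈ P := by
      refine hP.mem_of_pow_mem 2 ?_
      have e : (X 2 ^ 2 : MvPolynomial (Fin 3) K) =
          (C (coeff 0 R) * X l + (X 2 ^ 2 + X l * L) + X l * p₂) - X l * (C (coeff 0 R) + L + p₂) := by ring
      rw [e]; exact P.sub_mem hG (P.mul_mem_right _ hXl)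
    refine ⟨h2, ?_⟩
    rw [hdl] at hd
    have e : (C (coeff 0 R) + L + p₂ : MvPolynomial (Fin 3) K) =
        (C (coeff 0 R) + (L + X l * pderiv l L) + (p₂ + X l * pderiv l p₂)) - X l * (pderiv l L + pderiv l p₂) := by ring
    rw [e]; exact P.sub_mem hd (P.mul_mem_right _ hXl)
  · -- (iv)
    intro hc P hP hT
    refine ⟨l, fun hd => ?_⟩
    rw [hdl] at hd
    have hIP : I ≤ P := Ideal.span_le.mpr (Set.range_subset_iff.mpr fun i => hT i)
    have hLP : L ∈ P := hIP (mem_span_of_isHomogeneous_succ K hL)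
    have hp₂P : p₂ ∈ P := hIP (Ideal.pow_le_self (by norm_num) hp₂)
    have hC : (C (coeff 0 R) : MvPolynomial (Fin 3) K) ∈ P := by
      have e : (C (coeff 0 R) : MvPolynomial (Fin 3) K) =
          (C (coeff 0 R) + (L + X l * pderiv l L) + (p₂ + X l * pderiv l p₂)) - ((L + X l * pderiv l L) + (p₂ + X l * pderiv l p₂)) := by ring
      rw [e]
      exact P.sub_mem hd (P.add_mem (P.add_mem hLP (P.mul_mem_right _ (hT l))) (P.add_mem hp₂P (P.mul_mem_right _ (hT l))))
    exact hP.ne_top (P.eq_top_of_isUnit_mem hC ((isUnit_iff_ne_zero.mpr hc).map C))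

/-! ## A simple root of the cubic on the double line is a first-order exceptional point -/

/-- **(FO) for the exceptional tangent cone at a SIMPLE root**, every characteristic: `Φ' = T₂² + T₀(aT₀ + βT₁ + c'T₂)` with `β ≠ 0`, any next form:
a prime containing `Φ'` and its partials contains `βT₀ = ∂₁Φ'`, hence `T₀`, hence `T₂² ≡ Φ'`, hence `βT₁ ≡ ∂₀Φ'`. [cite: Hartshorne1977, I Thm. 5.1] -/
theorem firstOrder_doublePlane_disc (a β c' : K) (hβ : β ≠ 0) (Ψ₁ : MvPolynomial (Fin 3) K) (P : Ideal (MvPolynomial (Fin 3) K)) (hP : P.IsPrime)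
    (hΦ : (X 2 ^ 2 + X 0 * (C a * X 0 + C β * X 1 + C c' * X 2) : MvPolynomial (Fin 3) K) ∈ P)
    (hd : ∀ i, pderiv i (X 2 ^ 2 + X 0 * (C a * X 0 + C β * X 1 + C c' * X 2) : MvPolynomial (Fin 3) K) ∈ P)
    (_hΨ : Ψ₁ ∈ P) (i : Fin 3) : (X i : MvPolynomial (Fin 3) K) ∈ P := by
  have h0 : (X 0 : MvPolynomial (Fin 3) K) ∈ P := by
    have h := hd 1
    have hc : pderiv 1 (X 2 ^ 2 + X 0 * (C a * X 0 + C β * X 1 + C c' * X 2) : MvPolynomial (Fin 3) K) = C β * X 0 := by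
      simp only [map_add, pderiv_mul, pderiv_C, pderiv_pow, pderiv_X_self, pderiv_X_of_ne (show (0 : Fin 3) ≠ 1 by decide),
        pderiv_X_of_ne (show (2 : Fin 3) ≠ 1 by decide)]
      ring
    rw [hc] at h
    exact mem_of_C_mul_mem K hβ P hP h
  have h2 : (X 2 : MvPolynomial (Fin 3) K) ∈ P := by
    refine hP.mem_of_pow_mem 2 ?_
    have e : (X 2 ^ 2 : MvPolynomial (Fin 3) K) = (X 2 ^ 2 + X 0 * (C a * X 0 + C β * X 1 + C c' * X 2)) - X 0 * (C a * X 0 + C β * X 1 + C c' * X 2) := by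
      ring
    rw [e]; exact P.sub_mem hΦ (P.mul_mem_right _ h0)
  have h1 : (X 1 : MvPolynomial (Fin 3) K) ∈ P := by
    have h := hd 0
    have hc : pderiv 0 (X 2 ^ 2 + X 0 * (C a * X 0 + C β * X 1 + C c' * X 2) : MvPolynomial (Fin 3) K) =
        C β * X 1 + (2 * (C a * X 0) + C c' * X 2) := by
      simp only [map_add, pderiv_mul, pderiv_C, pderiv_pow, pderiv_X_self, pderiv_X_of_ne (show (1 : Fin 3) ≠ 0 by decide),
        pderiv_X_of_ne (show (2 : Fin 3) ≠ 0 by decide)]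
      ring
    rw [hc] at h
    have h' : (C β * X 1 : MvPolynomial (Fin 3) K) ∈ P := by
      have e : (C β * X 1 : MvPolynomial (Fin 3) K) = (C β * X 1 + (2 * (C a * X 0) + C c' * X 2)) - (2 * (C a * X 0) + C c' * X 2) := by ring
      rw [e]; exact P.sub_mem h (P.add_mem (P.mul_mem_left _ (P.mul_mem_left _ h0)) (P.mul_mem_left _ h2))
    exact mem_of_C_mul_mem K hβ P hP h'
  fin_cases i
  · exact h0
  · exact h1
  · exact h2

/-! ## ★★ Recognition at the origin of chart `0` -/

/-- The substitution `y₀ := 1` maps the ideal `(y₁, y₂)` onto itself. [folklore] -/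
theorem map_update₀_span12 :
    Ideal.map (aeval (Function.update (X : Fin 3 → MvPolynomial (Fin 3) K) 0 1)).toRingHom
        (Ideal.span {(X 1 : MvPolynomial (Fin 3) K), X 2}) = Ideal.span {(X 1 : MvPolynomial (Fin 3) K), X 2} := by
  rw [Ideal.map_span, Set.image_pair]
  simp only [AlgHom.toRingHom_eq_coe, RingHom.coe_coe, aeval_X]
  rw [Function.update_of_ne (by decide : (1 : Fin 3) ≠ 0), Function.update_of_ne (by decide : (2 : Fin 3) ≠ 0)]

/-- `(T₁, T₂) ≤ (T)`. [folklore] -/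
theorem span12_le_span : Ideal.span {(X 1 : MvPolynomial (Fin 3) K), X 2} ≤ Ideal.span (Set.range (X : Fin 3 → MvPolynomial (Fin 3) K)) :=
  Ideal.span_mono (by
    rintro _ (rfl | rfl)
    · exact ⟨1, rfl⟩
    · exact ⟨2, rfl⟩)

/-- ★★ **DOUBLE PLANE WITH A SIMPLE ROOT AT THE ORIGIN OF CHART `0` — recognition** (every field).
`f = y₂² + (y₀²(βy₁ + c'y₂) + Ψ₃⁰) + (a·y₀⁴ + Ψ₄⁰ + Ψ₅)`, `Ψ₃⁰ ∈ (y₁,y₂)²` a cubic form, `Ψ₄⁰ ∈ (y₁,y₂)` a quartic form, `Ψ₅ ∈ (y)⁵`, `β ≠ 0`.  Then there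
are a cubic form `Ψ₁'` and `Ψ'' ∈ (T)⁴` with, for `Φ' = T₂² + T₀(aT₀ + βT₁ + c'T₂)` and `G₀ = Φ' + (Ψ₁' + Ψ'')`: (i) `f(T₀, T₀T₁, T₀T₂) = T₀²·G₀`;
(ii) the origin of chart `0` is ONE-STEP for `G₀`: for every chart direction an explicit strict transform of `G₀` with the total-transform identity and
the Jacobian certificate along its exceptional divisor. [cite: Hartshorne1977, I Thm. 5.1, II Ex. 7.12] -/
theorem doublePlane_simpleRoot_chart₀ (a β c' : K) (hβ : β ≠ 0) {Ψ₃₀ Ψ₄₀ Ψ₅ : MvPolynomial (Fin 3) K}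
    (hΨ₃₀h : Ψ₃₀.IsHomogeneous 3) (hΨ₃₀ : Ψ₃₀ ∈ Ideal.span {(X 1 : MvPolynomial (Fin 3) K), X 2} ^ 2)
    (hΨ₄₀h : Ψ₄₀.IsHomogeneous 4) (hΨ₄₀ : Ψ₄₀ ∈ Ideal.span {(X 1 : MvPolynomial (Fin 3) K), X 2})
    (hΨ₅ : Ψ₅ ∈ Ideal.span (Set.range (X : Fin 3 → MvPolynomial (Fin 3) K)) ^ 5) :
    ∃ Ψ₁' Ψ'' : MvPolynomial (Fin 3) K, Ψ₁'.IsHomogeneous 3 ∧ Ψ'' ∈ Ideal.span (Set.range (X : Fin 3 → MvPolynomial (Fin 3) K)) ^ 4 ∧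
      aeval (fun j => X 0 * Function.update (X : Fin 3 → MvPolynomial (Fin 3) K) 0 1 j)
          (X 2 ^ 2 + (X 0 ^ 2 * (C β * X 1 + C c' * X 2) + Ψ₃₀) + (C a * X 0 ^ 4 + Ψ₄₀ + Ψ₅)) =
        X 0 ^ 2 * ((X 2 ^ 2 + X 0 * (C a * X 0 + C β * X 1 + C c' * X 2)) + (Ψ₁' + Ψ'')) ∧
      ∀ l : Fin 3, ∃ G' : MvPolynomial (Fin 3) K,
        aeval (fun j => X l * Function.update (X : Fin 3 → MvPolynomial (Fin 3) K) l 1 j)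
            ((X 2 ^ 2 + X 0 * (C a * X 0 + C β * X 1 + C c' * X 2)) + (Ψ₁' + Ψ'')) = X l ^ 2 * G' ∧
        ∀ P : Ideal (MvPolynomial (Fin 3) K), P.IsPrime → (X l : MvPolynomial (Fin 3) K) ∈ P → G' ∈ P → ∃ j, pderiv j G' ∉ P := by
  set u : Fin 3 → MvPolynomial (Fin 3) K := Function.update (X : Fin 3 → MvPolynomial (Fin 3) K) 0 1 with hu
  obtain ⟨R₅, hR₅⟩ := FirstOrderPoint.exists_aeval_subst_eq_pow_mul K 0 hΨ₅
  set E : MvPolynomial (Fin 3) K := X 0 * aeval u Ψ₃₀ + X 0 ^ 2 * aeval u Ψ₄₀ + X 0 ^ 3 * R₅ with hE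
  have hI : (X 0 : MvPolynomial (Fin 3) K) ∈ Ideal.span (Set.range (X : Fin 3 → MvPolynomial (Fin 3) K)) :=
    Ideal.subset_span (Set.mem_range_self (0 : Fin 3))
  have hu₃ : aeval u Ψ₃₀ ∈ Ideal.span {(X 1 : MvPolynomial (Fin 3) K), X 2} ^ 2 := by
    have h := Ideal.mem_map_of_mem (aeval u).toRingHom hΨ₃₀
    rwa [Ideal.map_pow, hu, map_update₀_span12] at h
  have hu₄ : aeval u Ψ₄₀ ∈ Ideal.span {(X 1 : MvPolynomial (Fin 3) K), X 2} := by
    have h := Ideal.mem_map_of_mem (aeval u).toRingHom hΨ₄₀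
    rwa [hu, map_update₀_span12] at h
  have hE3 : E ∈ Ideal.span (Set.range (X : Fin 3 → MvPolynomial (Fin 3) K)) ^ 3 := by
    refine Ideal.add_mem _ (Ideal.add_mem _ ?_ ?_) ?_
    · rw [pow_succ']
      exact Ideal.mul_mem_mul hI (Ideal.pow_right_mono (span12_le_span K) 2 hu₃)
    · rw [pow_succ]
      exact Ideal.mul_mem_mul (Ideal.pow_mem_pow hI 2) (span12_le_span K hu₄)
    · exact Ideal.mul_mem_right _ _ (Ideal.pow_mem_pow hI 3)
  refine ⟨homogeneousComponent 3 E, E - homogeneousComponent 3 E, homogeneousComponent_isHomogeneous 3 E,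
    sub_homogeneousComponent_mem_pow_succ K hE3, ?_, ?_⟩
  · -- (i) the total-transform identity
    have hβc : (X 0 ^ 2 * (C β * X 1 + C c' * X 2) : MvPolynomial (Fin 3) K).IsHomogeneous 3 := by
      have h := (isHomogeneous_X_pow (0 : Fin 3) 2 (R := K)).mul
        (((isHomogeneous_C (Fin 3) β).mul (isHomogeneous_X K (1 : Fin 3))).add
          ((isHomogeneous_C (Fin 3) c').mul (isHomogeneous_X K (2 : Fin 3))))
      simpa using h
    have ha : (C a * X 0 ^ 4 : MvPolynomial (Fin 3) K).IsHomogeneous 4 := by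
      simpa using (isHomogeneous_C (Fin 3) a).mul (isHomogeneous_X_pow (0 : Fin 3) 4 (R := K))
    rw [map_add, map_add, map_add, map_add, map_add, aeval_subst_X_two_sq K 0 (by decide),
      FirstOrderPoint.aeval_subst_of_isHomogeneous K 0 hβc, FirstOrderPoint.aeval_subst_of_isHomogeneous K 0 hΨ₃₀h,
      FirstOrderPoint.aeval_subst_of_isHomogeneous K 0 ha, FirstOrderPoint.aeval_subst_of_isHomogeneous K 0 hΨ₄₀h, hR₅, ← hu]
    have h1 : aeval u (X 0 ^ 2 * (C β * X 1 + C c' * X 2) : MvPolynomial (Fin 3) K) = C β * X 1 + C c' * X 2 := by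
      rw [map_mul, map_pow, aeval_X, map_add, map_mul, map_mul, aeval_C, aeval_C, aeval_X, aeval_X, hu, Function.update_self,
        Function.update_of_ne (by decide : (1 : Fin 3) ≠ 0), Function.update_of_ne (by decide : (2 : Fin 3) ≠ 0), algebraMap_eq]
      ring
    have h2 : aeval u (C a * X 0 ^ 4 : MvPolynomial (Fin 3) K) = C a := by
      rw [map_mul, map_pow, aeval_C, aeval_X, hu, Function.update_self, algebraMap_eq]
      ring
    rw [h1, h2, add_sub_cancel, hE]
    ring
  · -- (ii) one-step at the origin of chart `0`
    intro l
    have hΦ' : (X 2 ^ 2 + X 0 * (C a * X 0 + C β * X 1 + C c' * X 2) : MvPolynomial (Fin 3) K).IsHomogeneous 2 := by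
      have h22 := isHomogeneous_X_pow (2 : Fin 3) 2 (R := K)
      have hlin : (C a * X 0 + C β * X 1 + C c' * X 2 : MvPolynomial (Fin 3) K).IsHomogeneous 1 := by
        have h := (((isHomogeneous_C (Fin 3) a).mul (isHomogeneous_X K (0 : Fin 3))).add
          ((isHomogeneous_C (Fin 3) β).mul (isHomogeneous_X K (1 : Fin 3)))).add
          ((isHomogeneous_C (Fin 3) c').mul (isHomogeneous_X K (2 : Fin 3)))
        simpa using h
      have h := h22.add ((isHomogeneous_X K (0 : Fin 3)).mul hlin)
      simpa using h
    exact FirstOrderPoint.exists_strictTransform K _ _ _ hΦ' (homogeneousComponent_isHomogeneous 3 E)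
      (sub_homogeneousComponent_mem_pow_succ K hE3)
      (fun P hP hΦP hdP hΨP => firstOrder_doublePlane_disc K a β c' hβ _ P hP hΦP hdP hΨP) l

end SecondOrderPoint

end Summit.ResolutionOfSingularities.ResolutionOfSingularities.Cruxes.EquisingularLiftNat.Sections

end
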